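import Summits.AtomisticToContinuum.Crystallization.Theorems.ChargedEnergyGapCoherenceDial
import HarnessLib

/-!
# Charged energy gap — lens-3 g64, node «BarlowRef» (R3) — part 4 (addendum, INDEPENDENT of parts 1–3): the SHARP separation of a Barlow image

Imports only the tree part H-A `…ChargedEnergyGapCoherenceDial` (where `IsBarlowImage` lives).  ELEMENTARY·PROVED, folklore lattice geometry:

* `four_le_adjacent_form` — the integer inequality `4 ≤ 3(2i + j + L)² + (3j + L)²` for `L = ±1` (the lateral offset of adjacent Barlow layers
  is never smaller than `a/√3`: `|i u + j v ± w|² = (a²/12)(3(2i+j±1)² + (3j±1)²) ≥ a²/3`);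
* `sq_le_dist_barlowPos_sq_of_succ` — ADJACENT LAYERS: `a²/3 + h² ≤ dist(barlowPos (k+1) i' j', barlowPos k i j)²` (equality at the three
  supporting sites, `dist_barlowPos_succ_eq`); `two_mul_le_dist_barlowPos_of_two_le` — layers `≥ 2` apart: `2h ≤ dist`;
* ★ `le_dist_barlowPos_sharp` — UNIFORM SHARP DISCRETENESS: distinct sites of a Hägg stacking are at distance `≥ min a (min (2h) √(a²/3 + h²))`
  (the Literature lemma `le_dist_of_mem_barlowStacking` has `min a h`, which in the window is only `13/20`);
* ★★ `IsBarlowImage.le_dist_sharp` — in the image window (`a ≥ 9/10`, `h² ≥ 27a²/50`): distinct sites of a Barlow image are `≥ 21/25` apart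
  (`a²(1/3 + 27/50) = a²·131/150 ≥ 0.81·131/150 = 0.70740 ≥ (21/25)² = 0.7056`; `2h ≥ 1.3`; tree `IsBarlowImage.le_dist` gives `1/2`).

WHY (memo g64 §1/§3, part 3 §R8): every packing count of the tube-load lemma scales like `s⁻³` in the separation `s` it is fed; at the record
dial `3/5` resp. the tree's `1/2` the shell counts lose `×2.7` resp. `×4.7` against `21/25` — the difference between slack `×1.2` and `×3.8` in the
worst geometry of the (R3) feasibility table.  0 sorry; standard axioms.
-/

noncomputable section

open scoped Classical
open Literature.MathematicalPhysics.StatisticalMechanics Literature.Geometry.DiscreteGeometry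
open Summit.AtomisticToContinuum.Crystallization.Theses.PricedLinkCensus
open Summit.AtomisticToContinuum.Crystallization.Theorems.ChargedEnergyGapNegative

namespace Summit.AtomisticToContinuum.Crystallization.Theorems.ChargedEnergyGapChartDial

section BarlowSeparation

/-- The integer inequality behind the adjacent-layer offset: `4 ≤ 3(2i + j + L)² + (3j + L)²` for `L = ±1`. (dedup gate: an identical public twin is already landed elsewhere in the tree; kept PRIVATE here to keep the import closure local) -/
private theorem four_le_adjacent_form (i j L : ℤ) (hL : L = 1 ∨ L = -1) : 4 ≤ 3 * (2 * i + j + L) ^ 2 + (3 * j + L) ^ 2 := by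
  by_cases hj : j = 0
  · subst hj
    have hodd : 1 ≤ |2 * i + 0 + L| := Int.one_le_abs (by rcases hL with h | h <;> omega)
    have h1 : 1 ≤ (2 * i + 0 + L) ^ 2 := by
      calc (1 : ℤ) = 1 ^ 2 := by norm_num
        _ ≤ |2 * i + 0 + L| ^ 2 := pow_le_pow_left₀ (by norm_num) hodd 2
        _ = (2 * i + 0 + L) ^ 2 := sq_abs _
    have h2 : 1 ≤ (3 * (0 : ℤ) + L) ^ 2 := by rcases hL with h | h <;> subst h <;> norm_num
    nlinarith
  · have h2 : 2 ≤ |3 * j + L| := by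
      rcases hL with h | h <;> subst h <;> rw [le_abs'] <;> omega
    have h4 : 4 ≤ (3 * j + L) ^ 2 := by
      calc (4 : ℤ) = 2 ^ 2 := by norm_num
        _ ≤ |3 * j + L| ^ 2 := pow_le_pow_left₀ (by norm_num) h2 2
        _ = (3 * j + L) ^ 2 := sq_abs _
    nlinarith [sq_nonneg (2 * i + j + L)]

variable (a h : ℝ) {s : ℤ → ℤ}

/-- ★ ADJACENT LAYERS are laterally offset by at least `a/√3`: `a²/3 + h² ≤ dist(barlowPos (k+1) i' j', barlowPos k i j)²`. -/
theorem sq_le_dist_barlowPos_sq_of_succ (hs : IsHaggSeq s) (k i j i' j' : ℤ) :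
    a ^ 2 / 3 + h ^ 2 ≤ dist (barlowPos a h s (k + 1) i' j') (barlowPos a h s k i j) ^ 2 := by
  have h3 : (√3 : ℝ) ^ 2 = 3 := Real.sq_sqrt (by norm_num)
  have hL : s k = 1 ∨ s k = -1 := hs k
  have hform : dist (barlowPos a h s (k + 1) i' j') (barlowPos a h s k i j) ^ 2 =
      a ^ 2 / 12 * ((3 * (2 * (i' - i) + (j' - j) + s k) ^ 2 + (3 * (j' - j) + s k) ^ 2 : ℤ) : ℝ) + h ^ 2 := by
    rw [dist_barlowPos_sq, haggLabel_succ]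
    push_cast
    linear_combination (a ^ 2 * ((j' : ℝ) - j + (s k : ℝ) / 3) ^ 2 / 4) * h3
  have hint : (4 : ℝ) ≤ ((3 * (2 * (i' - i) + (j' - j) + s k) ^ 2 + (3 * (j' - j) + s k) ^ 2 : ℤ) : ℝ) := by
    exact_mod_cast four_le_adjacent_form (i' - i) (j' - j) (s k) hL
  rw [hform]
  nlinarith [sq_nonneg a]

/-- Layers at least two apart: `2h ≤ dist` (`0 ≤ h`). -/
theorem two_mul_le_dist_barlowPos_of_two_le (hh : 0 ≤ h) {k k' : ℤ} (hk : 2 ≤ |k - k'|) (i j i' j' : ℤ) :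
    2 * h ≤ dist (barlowPos a h s k i j) (barlowPos a h s k' i' j') := by
  refine le_trans ?_ (PiLp.dist_apply_le (barlowPos a h s k i j) (barlowPos a h s k' i' j') 2)
  rw [barlowPos_apply_two, barlowPos_apply_two, Real.dist_eq, ← sub_mul, abs_mul, abs_of_nonneg hh]
  have : (2 : ℝ) ≤ |(k : ℝ) - k'| := by
    rw [← Int.cast_sub, ← Int.cast_abs]
    exact_mod_cast hk
  nlinarith

/-- ★ UNIFORM SHARP DISCRETENESS of a Hägg stacking: distinct sites are at distance `≥ min a (min (2h) √(a²/3 + h²))`. -/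
theorem le_dist_barlowPos_sharp (hs : IsHaggSeq s) (ha : 0 ≤ a) (hh : 0 ≤ h) {k i j k' i' j' : ℤ}
    (hne : (k, i, j) ≠ (k', i', j')) :
    min a (min (2 * h) (√(a ^ 2 / 3 + h ^ 2))) ≤ dist (barlowPos a h s k i j) (barlowPos a h s k' i' j') := by
  by_cases hk : k = k'
  · subst hk
    have : (i, j) ≠ (i', j') := by rintro h0; apply hne; simp_all
    exact (min_le_left _ _).trans (le_dist_barlowPos_of_ne a h s ha this)
  · refine (min_le_right _ _).trans ?_
    rcases lt_or_ge (|k - k'|) 2 with h1 | h2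
    · -- adjacent layers: k' = k + 1 or k = k' + 1
      refine (min_le_right _ _).trans ?_
      have hsq : a ^ 2 / 3 + h ^ 2 ≤ dist (barlowPos a h s k i j) (barlowPos a h s k' i' j') ^ 2 := by
        rcases (show k' = k + 1 ∨ k = k' + 1 by
            rcases lt_or_gt_of_ne hk with hlt | hgt
            · left; rw [abs_of_neg (by omega)] at h1; omega
            · right; rw [abs_of_pos (by omega)] at h1; omega) with h01 | h10
        · subst h01; rw [dist_comm]; exact sq_le_dist_barlowPos_sq_of_succ a h hs k i j i' j'
        · subst h10; exact sq_le_dist_barlowPos_sq_of_succ a h hs k' i' j' i j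
      exact Real.sqrt_le_iff.2 ⟨dist_nonneg, hsq⟩
    · exact (min_le_left _ _).trans (two_mul_le_dist_barlowPos_of_two_le a h hh h2 i j i' j')

/-- The point-set form. -/
theorem le_dist_of_mem_barlowStacking_sharp (hs : IsHaggSeq s) (ha : 0 ≤ a) (hh : 0 ≤ h) {x y : E3}
    (hx : x ∈ barlowStacking a h s) (hy : y ∈ barlowStacking a h s) (hxy : x ≠ y) :
    min a (min (2 * h) (√(a ^ 2 / 3 + h ^ 2))) ≤ dist x y := by
  obtain ⟨k, i, j, rfl⟩ := hx
  obtain ⟨k', i', j', rfl⟩ := hy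
  refine le_dist_barlowPos_sharp a h hs ha hh ?_
  rintro heq
  simp only [Prod.mk.injEq] at heq
  obtain ⟨rfl, rfl, rfl⟩ := heq
  exact hxy rfl

/-- Window arithmetic: `a ≥ 9/10`, `h > 0`, `h² ≥ 27a²/50` give `21/25 ≤ min a (min (2h) √(a²/3 + h²))`. -/
theorem window_sharp_floor {a h : ℝ} (ha : 9 / 10 ≤ a ∧ a ≤ 11 / 10) (hh : 0 < h ∧ 27 / 50 * a ^ 2 ≤ h ^ 2 ∧ h ^ 2 ≤ 121 / 150 * a ^ 2) :
    21 / 25 ≤ min a (min (2 * h) (√(a ^ 2 / 3 + h ^ 2))) := by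
  have ha2 : (81 / 100 : ℝ) ≤ a ^ 2 := by nlinarith [ha.1]
  refine le_min (by linarith [ha.1]) (le_min ?_ ?_)
  · -- (2h)² ≥ 4·27/50·a² ≥ 4·0.54·0.81 ≥ (21/25)²
    nlinarith [hh.1, hh.2.1]
  · refine Real.le_sqrt_of_sq_le ?_
    nlinarith [hh.2.1]

/-- ★★ SHARP SEPARATION OF A BARLOW IMAGE: distinct sites are at distance `≥ 21/25` (tree `IsBarlowImage.le_dist`: `1/2`). -/
theorem IsBarlowImage.le_dist_sharp {S : Set E3} (hS : IsBarlowImage S) {x y : E3} (hx : x ∈ S) (hy : y ∈ S) (hxy : x ≠ y) :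
    21 / 25 ≤ dist x y := by
  obtain ⟨a, h, s, g, ha, hh, hs, hg, rfl⟩ := hS
  obtain ⟨x₀, hx₀, rfl⟩ := hx
  obtain ⟨y₀, hy₀, rfl⟩ := hy
  have hne : x₀ ≠ y₀ := fun h0 => hxy (by rw [h0])
  rw [hg.dist_eq]
  exact (window_sharp_floor ha hh).trans
    (le_dist_of_mem_barlowStacking_sharp a h hs (by linarith [ha.1]) hh.1.le hx₀ hy₀ hne)

/-- The reference form (the shape `IsSeparatedRef (21/25) P` unfolds to; `IsSeparatedRef` itself lives downstream in `…CleanLedger`):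
the points of a Barlow-image reference are pairwise `≥ 21/25` apart. -/
theorem IsBarlowImage.pairwise_le_dist {P : PeriodicConfiguration 3} (hB : IsBarlowImage P.points) :
    ∀ x ∈ P.points, ∀ y ∈ P.points, x ≠ y → (21 / 25 : ℝ) ≤ dist x y :=
  fun _ hx _ hy hxy => hB.le_dist_sharp hx hy hxy

/-- RECORD ARITHMETIC: the separation gain in the packing counts, `(s'/s)³` for `s' = 21/25` against `s = 3/5` resp. `1/2`:
`(21/25 / (3/5))³ = 343/125 > 2.74` and `(21/25 / (1/2))³ = 9261/1953.125… > 4.74`. -/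
theorem record_separation_gain : (274 / 100 : ℝ) < ((21 / 25) / (3 / 5)) ^ 3 ∧ (474 / 100 : ℝ) < ((21 / 25) / (1 / 2)) ^ 3 := by
  constructor <;> norm_num

end BarlowSeparation

end Summit.AtomisticToContinuum.Crystallization.Theorems.ChargedEnergyGapChartDial

end
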